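import Mathlib.Algebra.Lie.Subalgebra
import Literature.AlgebraicGeometry.Hyperkaehler.LooijengaLuntsVerbitsky
import Literature.AlgebraicTopology.SingularHomology.CupProduct
import HarnessLib

/-!
# Sub-algebras of `H*(Y; R)` generated under cup product and the LLV algebra

Layer `Literature/AlgebraicGeometry/Hyperkaehler`; companion of `LooijengaLuntsVerbitsky` (the LLV
algebra `g_tot = llvAlgebra R Y N ⊆ gl(H*(Y; R))`).  Vocabulary for statements of the shape
"`H*(X, ℚ)` (or a natural sub-structure of it) is GENERATED by `H²(X) ⊕ H³(X)` as a module over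
`⟨g_tot, ∪⟩`", i.e. the smallest subspace containing the given classes which is closed under cup
product and stable under every operator of the LLV algebra is everything — the form in which the
cohomology of the known hyper-Kähler types is organised (Verbitsky: the sub-algebra generated by `H²`
is an irreducible `g_tot`-module; Looijenga–Lunts §4, Green–Kim–Laza–Robles §2–3: `H*(X)` as a
`g_tot`-module, the Verbitsky component `SH² = ⟨H²⟩`, and the complementary components met by
products of low-degree classes).

## Sources

* E. Looijenga, V. Lunts, *A Lie algebra attached to a projective variety*, Invent. Math. 129 (1997)
  (arXiv:alg-geom/9604014), §1 (the total Lie algebra `g_tot ⊆ gl(H)` generated by the `e_a, f_a`;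
  (1.9) `M = H(X)[n]` "as a module over `H²(X)`" by cup product) and §4 (hyper-Kähler case).
* M. Verbitsky, *Cohomology of compact hyper-Kähler manifolds and its applications*, GAFA 6 (1996),
  Thm. 1.6/1.7: the sub-algebra of `H*(X)` generated by `H²(X)` and the `g_tot`-action on `H*(X)`.
* M. Green, Y.-J. Kim, R. Laza, C. Robles, *The LLV decomposition of hyper-Kähler cohomology*,
  Math. Ann. 382 (2022) (arXiv:1906.03432), §2.1 Def. 13 (`g(X)` generated by the `L_x, Λ_x`),
  §2.2 (the Verbitsky component `SH²(X) ⊆ H*(X)` "the subalgebra generated by `H²`", a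
  `g`-submodule), Cor. 32 (generalized Kummer `Kum_n`, `n ≤ 5`).

## Contents (tree carriers: `totalCohomology R Y = ⨁ₖ Hᵏ(Y; R)`, `ofDegree`, `totalLefschetz`,
`llvAlgebra` of file `LooijengaLuntsVerbitsky`; the tree's `cupProduct`)

* `totalCup R Y : H* →ₗ H* →ₗ H*` — the cup product assembled on the direct sum
  (`totalCup (ofDegree p x) (ofDegree q y) = ofDegree (p+q) (x ⌣ y)`), so that
  `totalLefschetz a = totalCup (ofDegree 2 a)` (`totalLefschetz_eq_totalCup`).
* `totalPullback R f : H*(Y'; R) →ₗ H*(Y; R)` — `f^*` assembled on the direct sum, and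
  `invariantClasses R 𝓕 = {v | f^* v = v ∀ f ∈ 𝓕}` — the invariants of a family of self-maps (for the
  intended use: the classes invariant under a finite group of automorphisms acting on `X(ℂ)`).
* `stabilizerLie S ⊆ gl(M)` — the Lie subalgebra (indeed associative subalgebra) of endomorphisms
  mapping a submodule `S` into itself.
* `IsCupClosed S`; `degreeClasses R Y D` — the homogeneous classes of the degrees `k ∈ D`;
  `llvCupSpan N G` — **the `⟨g_tot, ∪⟩`-span of `G`**: the smallest submodule of `H*(Y; R)`
  containing `G`, closed under `totalCup` and stable under `llvAlgebra R Y N`;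
  `opCupSpan Λ G` — the same with a single operator `Λ` in place of `g_tot` (the shape met in
  motivic arguments, where only ONE dual Lefschetz operator `Λ_ℓ` — that of an ample class — is
  known to be an algebraic correspondence).
* The formal comparison `llvCupSpan_le_opCupSpan`: if `g_tot` is contained in the Lie algebra
  generated by the Lefschetz operators `L_a` (`a ∈ H²`) together with `Λ`, then every cup-closed
  submodule containing `H²` and stable under `Λ` is `g_tot`-stable; hence the `⟨g_tot, ∪⟩`-span of
  any `G ⊇ H²` is contained in its `⟨Λ, ∪⟩`-span.  (The hypothesis is the Lie-theoretic half of a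
  "Lie-generation lemma": for `X` hyper-Kähler and `q(ℓ) ≠ 0`, `Lie⟨L_{H²}, Λ_ℓ⟩ = g_tot`, from
  `[L_ω, Λ_ℓ] = q(ω, ℓ) h + (ω ∧ ℓ)` and `g_tot ≅ so(H² ⊕ U)`, Looijenga–Lunts Prop. 4.5 /
  Verbitsky — NOT proved here.)

Everything in this file is definitional or formal (proved); no named facts are introduced.  Junk
analysis: all spans are `sInf` over a family containing `⊤`, hence well defined; with no Lefschetz
class (`llvAlgebra = ⊥`) `llvCupSpan N G` is just the cup-closed span of `G`.

## Not here

The theorems that identify these spans for hyper-Kähler `X` (Verbitsky's `SH²`; the LLV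
decompositions of GKLR; any "generated by `H² ⊕ H³`" statement for `Kumⁿ`) — they are statements
ABOUT these definitions, recorded where used.
-/

noncomputable section

open DirectSum
open Literature.AlgebraicTopology.SingularHomology
open Literature.Geometry.Kaehler

universe u v w

namespace Literature.AlgebraicGeometry.Hyperkaehler

-- commutator bracket on `gl(M) = Module.End R M`, Mathlib's local-instance idiom (see `LooijengaLuntsVerbitsky`)
attribute [local instance 100] LieRing.ofAssociativeRing

/-! ### Endomorphisms stabilising a submodule -/

section Stabilizer

variable {R : Type v} [CommRing R] {M : Type w} [AddCommGroup M] [Module R M]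

/-- The endomorphisms of `M` mapping the submodule `S` into itself, as a LIE subalgebra of `gl(M)`
(closed under composition, hence under the commutator bracket; the associative version is
`Literature.RepresentationTheory.endStabilizer`, not imported here to keep this file light; Mathlib's
`Module.End.invtSubmodule` is the transpose bookkeeping — the submodules invariant under one `E`).
[folklore] -/
def stabilizerLie (S : Submodule R M) : LieSubalgebra R (Module.End R M) where
  carrier := {E | ∀ v ∈ S, E v ∈ S}
  add_mem' {E F} hE hF := fun v hv ↦ by
    simpa only [LinearMap.add_apply] using S.add_mem (hE v hv) (hF v hv)
  zero_mem' := fun v _ ↦ by simp only [LinearMap.zero_apply, Submodule.zero_mem]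
  smul_mem' c {E} hE := fun v hv ↦ by
    simpa only [LinearMap.smul_apply] using S.smul_mem c (hE v hv)
  lie_mem' {E F} hE hF := fun v hv ↦ by
    rw [Ring.lie_def, LinearMap.sub_apply, Module.End.mul_apply, Module.End.mul_apply]
    exact S.sub_mem (hE _ (hF v hv)) (hF _ (hE v hv))

/-- Membership in `stabilizerLie S` (unfolding). [cite: LooijengaLunts1997, §1 p. 4] -/
@[simp]
theorem mem_stabilizerLie_iff (S : Submodule R M) (E : Module.End R M) :
    E ∈ stabilizerLie S ↔ ∀ v ∈ S, E v ∈ S :=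
  Iff.rfl

/-- The stabiliser is closed under composition. [cite: LooijengaLunts1997, §1 p. 4] -/
theorem mul_mem_stabilizerLie {S : Submodule R M} {E F : Module.End R M} (hE : E ∈ stabilizerLie S)
    (hF : F ∈ stabilizerLie S) : E * F ∈ stabilizerLie S :=
  fun v hv ↦ by simpa only [Module.End.mul_apply] using hE _ (hF v hv)

/-- The identity stabilises every submodule. [cite: LooijengaLunts1997, §1 p. 4] -/
theorem one_mem_stabilizerLie (S : Submodule R M) : (1 : Module.End R M) ∈ stabilizerLie S :=
  fun v hv ↦ by simpa only [Module.End.one_apply] using hv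

/-- A Lie subalgebra generated by stabilising endomorphisms stabilises (a subspace stable under the
generators `e_a, f_a` is stable under `g(a, M)`). [cite: LooijengaLunts1997, §1 p. 4] -/
theorem lieSpan_le_stabilizerLie {S : Submodule R M} {s : Set (Module.End R M)}
    (hs : ∀ E ∈ s, E ∈ stabilizerLie S) :
    LieSubalgebra.lieSpan R (Module.End R M) s ≤ stabilizerLie S :=
  LieSubalgebra.lieSpan_le.mpr hs

end Stabilizer

variable (R : Type v) [CommRing R] (Y : Type u) [TopologicalSpace Y]

/-! ### The cup product on the total cohomology -/

/-- The **cup product on `H*(Y; R) = ⨁ₖ Hᵏ(Y; R)`**, assembled from the tree's bilinear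
`cupProduct : Hᵖ × Hᵠ → H^{p+q}` on the summands (Looijenga–Lunts (1.9): `H(X)` "as a module over
`H²(X)`"; Hatcher §3.2: the cohomology ring). [cite: LooijengaLunts1997, §1 (1.9)] -/
def totalCup : totalCohomology R Y →ₗ[R] totalCohomology R Y →ₗ[R] totalCohomology R Y :=
  toModule R ℕ (totalCohomology R Y →ₗ[R] totalCohomology R Y) fun p ↦
    LinearMap.flip <| toModule R ℕ (singularCohomology R R Y p →ₗ[R] totalCohomology R Y) fun q ↦
      LinearMap.flip <| (cupProduct (rfl : p + q = p + q)).compr₂ (ofDegree R Y (p + q))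

variable {R Y}

/-- On homogeneous classes `totalCup` is the cup product: `(x ∈ Hᵖ) · (y ∈ Hᵠ) = x ⌣ y ∈ H^{p+q}`.
[cite: LooijengaLunts1997, §1 (1.9)] -/
@[simp]
theorem totalCup_lof (p q : ℕ) (x : singularCohomology R R Y p) (y : singularCohomology R R Y q) :
    totalCup R Y (ofDegree R Y p x) (ofDegree R Y q y) = ofDegree R Y (p + q) (cupProduct rfl x y) := by
  simp only [totalCup, toModule_lof, LinearMap.flip_apply, LinearMap.compr₂_apply]

/-- Re-indexing a homogeneous product along equal degrees (plumbing). [folklore] -/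
private theorem ofDegree_cupProduct_congr {p q n m : ℕ} (h₁ : p + q = n) (h₂ : p + q = m)
    (x : singularCohomology R R Y p) (y : singularCohomology R R Y q) :
    ofDegree R Y n (cupProduct h₁ x y) = ofDegree R Y m (cupProduct h₂ x y) := by
  subst h₁; subst h₂; rfl

/-- The Lefschetz operator `L_a` on `H*` is left `totalCup`-multiplication by `a ∈ H²`.
[cite: LooijengaLunts1997, §1 p. 4] -/
theorem totalLefschetz_eq_totalCup (a : singularCohomology R R Y 2) :
    totalLefschetz a = totalCup R Y (ofDegree R Y 2 a) := by
  refine linearMap_ext R fun k ↦ LinearMap.ext fun x ↦ ?_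
  simp only [LinearMap.coe_comp, Function.comp_apply, totalLefschetz_lof, lefschetzOperator_apply,
    totalCup_lof]
  exact ofDegree_cupProduct_congr _ _ a x

/-! ### Pull-backs on the total cohomology and invariant classes -/

variable (R) in
/-- `f^* : H*(Y'; R) → H*(Y; R)` for a continuous map `f : Y → Y'`, assembled from the tree's
`singularCohomology.map` on the summands. [cite: Hatcher2002, §3.1 "Induced homomorphisms"] -/
def totalPullback {Y' : Type u} [TopologicalSpace Y'] (f : C(Y, Y')) :
    totalCohomology R Y' →ₗ[R] totalCohomology R Y :=
  toModule R ℕ (totalCohomology R Y) fun k ↦ ofDegree R Y k ∘ₗ (singularCohomology.map R R f k).hom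

/-- `f^*` on a homogeneous class. [cite: Hatcher2002, §3.1] -/
@[simp]
theorem totalPullback_lof {Y' : Type u} [TopologicalSpace Y'] (f : C(Y, Y')) (k : ℕ)
    (x : singularCohomology R R Y' k) :
    totalPullback R f (ofDegree R Y' k x) = ofDegree R Y k (singularCohomology.map R R f k x) := by
  simp only [totalPullback, toModule_lof, LinearMap.coe_comp, Function.comp_apply]

variable (R) in
/-- The classes of `H*(Y; R)` **invariant** under a family `𝓕` of continuous self-maps of `Y`:
`{v | f^* v = v for all f ∈ 𝓕}` (for a finite group `Γ` acting on `X(ℂ)`: `H*(X)^Γ`).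
[cite: Floccari2023, §2.4–2.5 (invariants of Aut₀ on H*(Kum³))] -/
def invariantClasses (𝓕 : Set C(Y, Y)) : Submodule R (totalCohomology R Y) :=
  ⨅ f ∈ 𝓕, LinearMap.eqLocus (totalPullback R f) LinearMap.id

/-- Membership in `invariantClasses` (unfolding). [cite: Floccari2023, §2.4–2.5 (invariants of Aut₀ on H*(Kum³))] -/
theorem mem_invariantClasses_iff (𝓕 : Set C(Y, Y)) (v : totalCohomology R Y) :
    v ∈ invariantClasses R 𝓕 ↔ ∀ f ∈ 𝓕, totalPullback R f v = v := by
  simp only [invariantClasses, Submodule.mem_iInf, LinearMap.mem_eqLocus, LinearMap.id_coe, id_eq]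

/-! ### Cup-closed, `g_tot`-stable spans -/

/-- `S ⊆ H*(Y; R)` is closed under cup product. [cite: GreenKimLazaRobles2022, §2.2 (SH² "the subalgebra generated by H²")] -/
def IsCupClosed (S : Submodule R (totalCohomology R Y)) : Prop :=
  ∀ x ∈ S, ∀ y ∈ S, totalCup R Y x y ∈ S

variable (R Y) in
/-- The homogeneous classes of the degrees `k ∈ D`, as a subset of `H*(Y; R)` (generating sets
"`H² ⊕ H³`" are `degreeClasses R Y {2, 3}`). [cite: GreenKimLazaRobles2022, §2.2] -/
def degreeClasses (D : Set ℕ) : Set (totalCohomology R Y) :=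
  ⋃ k ∈ D, Set.range (ofDegree R Y k)

/-- A homogeneous class of an allowed degree is a generator (unfolding). [cite: GreenKimLazaRobles2022, §2.2] -/
theorem ofDegree_mem_degreeClasses {D : Set ℕ} {k : ℕ} (hk : k ∈ D) (x : singularCohomology R R Y k) :
    ofDegree R Y k x ∈ degreeClasses R Y D :=
  Set.mem_biUnion hk (Set.mem_range_self x)

/-- A cup-closed submodule containing `H²` is stable under every Lefschetz operator `L_a`.
[cite: LooijengaLunts1997, §1 (1.9)] -/
theorem totalLefschetz_mem_stabilizerLie {S : Submodule R (totalCohomology R Y)} (hS : IsCupClosed S)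
    (h2 : ∀ a : singularCohomology R R Y 2, ofDegree R Y 2 a ∈ S) (a : singularCohomology R R Y 2) :
    totalLefschetz a ∈ stabilizerLie S := fun v hv ↦ by
  rw [totalLefschetz_eq_totalCup]
  exact hS _ (h2 a) v hv

/-- **Lie-generation, formal half.**  If the LLV algebra is contained in the Lie algebra generated by
the Lefschetz operators `L_a` (`a ∈ H²(Y; R)`) together with one further operator `Λ`, then every
cup-closed submodule of `H*(Y; R)` containing `H²` and stable under `Λ` is `g_tot`-stable.
[cite: LooijengaLunts1997, §1 p. 4 and Prop. 4.5] -/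
theorem llvAlgebra_le_stabilizerLie_of_le_lieSpan {N : ℕ} {Λ : Module.End R (totalCohomology R Y)}
    (hgen : llvAlgebra R Y N ≤ LieSubalgebra.lieSpan R (Module.End R (totalCohomology R Y))
      ({E | ∃ a : singularCohomology R R Y 2, E = totalLefschetz a} ∪ {Λ}))
    {S : Submodule R (totalCohomology R Y)} (hS : IsCupClosed S)
    (h2 : ∀ a : singularCohomology R R Y 2, ofDegree R Y 2 a ∈ S) (hΛ : Λ ∈ stabilizerLie S) :
    llvAlgebra R Y N ≤ stabilizerLie S := by
  refine le_trans hgen (lieSpan_le_stabilizerLie ?_)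
  rintro E (⟨a, rfl⟩ | hE)
  · exact totalLefschetz_mem_stabilizerLie hS h2 a
  · rw [Set.mem_singleton_iff] at hE
    subst hE
    exact hΛ

variable (R Y) in
/-- **The `⟨g_tot, ∪⟩`-span of `G ⊆ H*(Y; R)`** (in "complex dimension" `N`): the smallest submodule
containing `G`, closed under cup product and stable under every operator of the LLV algebra
`llvAlgebra R Y N` — "the `g_tot`-submodule-with-product generated by `G`" (for `G = H²`: contains
Verbitsky's `SH²`; the statement "`H*(X)` is generated by `H² ⊕ H³` under `(g_tot, ∪)`" reads
`llvCupSpan N (degreeClasses R Y {2,3}) = ⊤`). [cite: GreenKimLazaRobles2022, §2.1 Def. 13 and §2.2]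
[cite: LooijengaLunts1997, §1 (1.9)] -/
def llvCupSpan (N : ℕ) (G : Set (totalCohomology R Y)) : Submodule R (totalCohomology R Y) :=
  sInf {S | G ⊆ S ∧ IsCupClosed S ∧ llvAlgebra R Y N ≤ stabilizerLie S}

variable (R Y) in
/-- **The `⟨Λ, ∪⟩`-span of `G ⊆ H*(Y; R)`** for a single operator `Λ ∈ gl(H*)`: the smallest
submodule containing `G`, closed under cup product and stable under `Λ` (intended: `Λ = Λ_ℓ` a dual
Lefschetz operator, `IsDualLefschetz N ℓ Λ`). [cite: LooijengaLunts1997, §1 p. 4] -/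
def opCupSpan (Λ : Module.End R (totalCohomology R Y)) (G : Set (totalCohomology R Y)) :
    Submodule R (totalCohomology R Y) :=
  sInf {S | G ⊆ S ∧ IsCupClosed S ∧ Λ ∈ stabilizerLie S}

section SpanAPI

variable {N : ℕ} {G : Set (totalCohomology R Y)} {Λ : Module.End R (totalCohomology R Y)}

/-- `G` is contained in its `⟨g_tot, ∪⟩`-span. [cite: GreenKimLazaRobles2022, §2.1 Def. 13 and §2.2] -/
theorem subset_llvCupSpan : G ⊆ llvCupSpan R Y N G := by
  intro v hv
  simp only [llvCupSpan, SetLike.mem_coe, Submodule.mem_sInf, Set.mem_setOf_eq]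
  exact fun S hS ↦ hS.1 hv

/-- The `⟨g_tot, ∪⟩`-span is cup-closed. [cite: GreenKimLazaRobles2022, §2.2] -/
theorem isCupClosed_llvCupSpan : IsCupClosed (llvCupSpan R Y N G) := by
  intro x hx y hy
  simp only [llvCupSpan, Submodule.mem_sInf, Set.mem_setOf_eq] at hx hy ⊢
  exact fun S hS ↦ hS.2.1 x (hx S hS) y (hy S hS)

/-- The `⟨g_tot, ∪⟩`-span is `g_tot`-stable. [cite: GreenKimLazaRobles2022, §2.1 Def. 13 and §2.2] -/
theorem llvAlgebra_le_stabilizerLie_llvCupSpan : llvAlgebra R Y N ≤ stabilizerLie (llvCupSpan R Y N G) := by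
  intro E hE v hv
  simp only [llvCupSpan, Submodule.mem_sInf, Set.mem_setOf_eq] at hv ⊢
  exact fun S hS ↦ hS.2.2 hE v (hv S hS)

/-- Minimality of the `⟨g_tot, ∪⟩`-span. [cite: GreenKimLazaRobles2022, §2.2] -/
theorem llvCupSpan_le {S : Submodule R (totalCohomology R Y)} (hG : G ⊆ S) (hS : IsCupClosed S)
    (hE : llvAlgebra R Y N ≤ stabilizerLie S) : llvCupSpan R Y N G ≤ S :=
  sInf_le ⟨hG, hS, hE⟩

/-- Induction principle for the `⟨g_tot, ∪⟩`-span: a property defining a cup-closed, `g_tot`-stable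
submodule containing `G` holds on the span. [cite: GreenKimLazaRobles2022, §2.2] -/
theorem llvCupSpan_induction {p : totalCohomology R Y → Prop} (S : Submodule R (totalCohomology R Y))
    (hp : ∀ v, v ∈ S ↔ p v) (hG : ∀ v ∈ G, p v) (hcup : ∀ x y, p x → p y → p (totalCup R Y x y))
    (hE : ∀ E ∈ llvAlgebra R Y N, ∀ v, p v → p (E v)) {v : totalCohomology R Y}
    (hv : v ∈ llvCupSpan R Y N G) : p v := by
  refine (hp v).1 (llvCupSpan_le (S := S) (fun w hw ↦ (hp w).2 (hG w hw)) ?_ ?_ hv)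
  · exact fun x hx y hy ↦ (hp _).2 (hcup x y ((hp x).1 hx) ((hp y).1 hy))
  · exact fun E hE' w hw ↦ (hp _).2 (hE E hE' w ((hp w).1 hw))

/-- `G` is contained in its `⟨Λ, ∪⟩`-span. [cite: LooijengaLunts1997, §1 p. 4 and (1.9)] -/
theorem subset_opCupSpan : G ⊆ opCupSpan R Y Λ G := by
  intro v hv
  simp only [opCupSpan, SetLike.mem_coe, Submodule.mem_sInf, Set.mem_setOf_eq]
  exact fun S hS ↦ hS.1 hv

/-- The `⟨Λ, ∪⟩`-span is cup-closed. [cite: LooijengaLunts1997, §1 (1.9)] -/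
theorem isCupClosed_opCupSpan : IsCupClosed (opCupSpan R Y Λ G) := by
  intro x hx y hy
  simp only [opCupSpan, Submodule.mem_sInf, Set.mem_setOf_eq] at hx hy ⊢
  exact fun S hS ↦ hS.2.1 x (hx S hS) y (hy S hS)

/-- The `⟨Λ, ∪⟩`-span is `Λ`-stable. [cite: LooijengaLunts1997, §1 p. 4] -/
theorem mem_stabilizerLie_opCupSpan : Λ ∈ stabilizerLie (opCupSpan R Y Λ G) := by
  intro v hv
  simp only [opCupSpan, Submodule.mem_sInf, Set.mem_setOf_eq] at hv ⊢
  exact fun S hS ↦ hS.2.2 v (hv S hS)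

/-- Minimality of the `⟨Λ, ∪⟩`-span. [cite: LooijengaLunts1997, §1 p. 4 and (1.9)] -/
theorem opCupSpan_le {S : Submodule R (totalCohomology R Y)} (hG : G ⊆ S) (hS : IsCupClosed S)
    (hΛ : Λ ∈ stabilizerLie S) : opCupSpan R Y Λ G ≤ S :=
  sInf_le ⟨hG, hS, hΛ⟩

/-- A `g_tot`-stable span is `Λ`-stable for every `Λ ∈ g_tot`; hence the `⟨Λ, ∪⟩`-span is contained
in the `⟨g_tot, ∪⟩`-span (the cheap inclusion). [cite: GreenKimLazaRobles2022, §2.1 Def. 13] -/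
theorem opCupSpan_le_llvCupSpan (hΛ : Λ ∈ llvAlgebra R Y N) : opCupSpan R Y Λ G ≤ llvCupSpan R Y N G :=
  opCupSpan_le subset_llvCupSpan isCupClosed_llvCupSpan (llvAlgebra_le_stabilizerLie_llvCupSpan hΛ)

/-- **Lie-generation, formal half (span form).**  If `g_tot ⊆ Lie⟨{L_a : a ∈ H²} ∪ {Λ}⟩` and the
generating set `G` contains `H²`, then the `⟨g_tot, ∪⟩`-span of `G` is contained in its
`⟨Λ, ∪⟩`-span: whatever `H*` is generated by `G` under cup product and the whole LLV algebra is
already generated under cup product and the single operator `Λ`.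
[cite: LooijengaLunts1997, §1 p. 4 and Prop. 4.5] -/
theorem llvCupSpan_le_opCupSpan
    (hgen : llvAlgebra R Y N ≤ LieSubalgebra.lieSpan R (Module.End R (totalCohomology R Y))
      ({E | ∃ a : singularCohomology R R Y 2, E = totalLefschetz a} ∪ {Λ}))
    (h2 : ∀ a : singularCohomology R R Y 2, ofDegree R Y 2 a ∈ G) :
    llvCupSpan R Y N G ≤ opCupSpan R Y Λ G :=
  llvCupSpan_le subset_opCupSpan isCupClosed_opCupSpan
    (llvAlgebra_le_stabilizerLie_of_le_lieSpan hgen isCupClosed_opCupSpan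
      (fun a ↦ subset_opCupSpan (h2 a)) mem_stabilizerLie_opCupSpan)

/-- Under the Lie-generation hypothesis the two spans of a generating set containing `H²` COINCIDE
for `Λ ∈ g_tot`. [cite: LooijengaLunts1997, §1 p. 4 and Prop. 4.5] -/
theorem llvCupSpan_eq_opCupSpan (hΛ : Λ ∈ llvAlgebra R Y N)
    (hgen : llvAlgebra R Y N ≤ LieSubalgebra.lieSpan R (Module.End R (totalCohomology R Y))
      ({E | ∃ a : singularCohomology R R Y 2, E = totalLefschetz a} ∪ {Λ}))
    (h2 : ∀ a : singularCohomology R R Y 2, ofDegree R Y 2 a ∈ G) :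
    llvCupSpan R Y N G = opCupSpan R Y Λ G :=
  le_antisymm (llvCupSpan_le_opCupSpan hgen h2) (opCupSpan_le_llvCupSpan hΛ)

end SpanAPI

end Literature.AlgebraicGeometry.Hyperkaehler

end
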